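import Mathlib
import Summits.NavierStokesRegularity.NavierStokesRegularity.Theorems.EulerZoomLiouvillePowerGaugeEulerLiouvilleBackwardVanishing
import Summits.NavierStokesRegularity.NavierStokesRegularity.Theorems.EulerZoomLiouvillePowerGaugeEulerLiouvilleRecurrentPastSmearing
import HarnessLib

/-!
# Crux `EulerZoomLiouville.PowerGaugeEulerLiouville` (stmt-NavierStokesRegularity-19832), line `recurrent-past`, stub R2 — brick 2:
# RECURRENT SLICES VANISH (`stub_recurrentSlicesZero`, signature unfolded)

Route №10 `EulerZoomLiouville` (NavierStokesRegularity), crux E.  Line `recurrent-past` (ideator ns-idea-11 g3;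
`Cruxes/PowerGaugeEulerLiouville/Lines/recurrent_past.lean`), registered stub `stub_recurrentSlicesZero` (R2, «M»), proved here with the
line's `Sig.stub_densityMeet`, `InClass`, `WindowDensityZero`, `returnSet` δ-UNFOLDED (so the skeleton fills the stub by `exact`).  Seat
ns-ezl-w3 (default pick after A2 / D2′ / R1).

THE STATEMENT.  Given R1 (a set of non-zero window density meets the complement of a set of window density zero): for a member `(u,p,H,c)` of
Seregin's power-gauged ancient Euler class (`ρ > 0`) and `T₁ ≤ 0`, if for a.e. `τ₀ < T₁` the slice `u(τ₀)` is POINCARÉ-RECURRENT — for all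
`R, ε > 0` there is a window length `h > 0` such that the return set
`{σ < 0 : ∫_{σ−h}^{σ} ∫_{B_R} |u(τ) − u(τ₀)|² dτ < hε}` does NOT have window density zero — then `∫ |u(τ)|² = 0` for a.e. `τ < T₁`
(the hypothesis `hzero` of the landed far-past filler `PastSymmetric.ae_eq_zero_of_gauge_of_pastSlicesZero`).

THE PROOF (the line card's).  Fix a recurrent `τ₀` that is also a good slice of a measurable modification `ũ` of `u` (Fubini), and
`R, ε`.  The bad set `Bad = {τ < 0 : ∫_{B_R}|u(τ)|² > ε}` has window density zero (tree `Backward.vanishesBackward_of_gauge`, from the `A`-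
and `E`-gauges); so does its measurable twin `Bad′` (same a.e.) and hence the smeared set `S = {σ : |Bad′ ∩ (σ−h,σ)| > h/2}` (brick 1).
R1 gives a return `σ ∉ S`; Chebyshev on the return window bounds `|{τ ∈ (σ−h,σ) : ∫_{B_R}|ũ(τ)−ũ(τ₀)|² ≥ 4ε}| ≤ h/4`; brick 1's
`exists_good_time_in_window` yields `τ` in the window, outside `Bad′`, below `4ε`, and a good slice; then
`∫_{B_R}|u(τ₀)|² ≤ 2∫_{B_R}|u(τ)|² + 2∫_{B_R}|u(τ)−u(τ₀)|² ≤ 10ε`.  All `ε`, then all `R` (balls `B(0,n+1)` exhaust `ℝ³`).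

WHAT THIS IS NOT: not NS, not the crux — a helper `--supports` stmt-19832 (R3 `stub_wanderingRest` is the line's open residue); 19832 is a
crux CLASS of Euler/NS strata and stays OPEN; nothing here bears on NS regularity. [folklore]
-/

noncomputable section

-- flat `Theorems/<Route><Decl>…` files of one crux share the namespace of the crux (tree convention)
set_option linter.dupNamespace false

open MeasureTheory Set Filter Topology Metric Function
open scoped ENNReal NNReal Topology

namespace Summit.NavierStokesRegularity.NavierStokesRegularity.Theorems.PowerGaugeEulerLiouville.RecurrentPast

open Literature.Analysis Literature.Analysis.FluidPDE

/-- `‖a‖² ≤ 2‖b‖² + 2‖b − a‖²` in `ℝ≥0∞` (triangle inequality `‖a‖ ≤ ‖b‖ + ‖b − a‖`). [folklore] -/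
theorem enorm_sq_le_two_mul_add (a b : EuclideanSpace ℝ (Fin 3)) :
    ‖a‖ₑ ^ 2 ≤ 2 * ‖b‖ₑ ^ 2 + 2 * ‖b - a‖ₑ ^ 2 := by
  have h : ‖a‖ ≤ ‖b‖ + ‖b - a‖ := by
    calc ‖a‖ = ‖b - (b - a)‖ := by rw [sub_sub_cancel]
      _ ≤ ‖b‖ + ‖b - a‖ := norm_sub_le _ _
  have hr : ‖a‖ ^ 2 ≤ 2 * ‖b‖ ^ 2 + 2 * ‖b - a‖ ^ 2 := by
    nlinarith [norm_nonneg a, norm_nonneg b, norm_nonneg (b - a), sq_nonneg (‖b‖ - ‖b - a‖)]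
  have e : ∀ v : EuclideanSpace ℝ (Fin 3), ‖v‖ₑ ^ 2 = ENNReal.ofReal (‖v‖ ^ 2) := fun v => by
    rw [← ofReal_norm, ← ENNReal.ofReal_pow (norm_nonneg _)]
  rw [e a, e b, e (b - a)]
  calc ENNReal.ofReal (‖a‖ ^ 2) ≤ ENNReal.ofReal (2 * ‖b‖ ^ 2 + 2 * ‖b - a‖ ^ 2) := ENNReal.ofReal_le_ofReal hr
    _ = 2 * ENNReal.ofReal (‖b‖ ^ 2) + 2 * ENNReal.ofReal (‖b - a‖ ^ 2) := by
        rw [ENNReal.ofReal_add (by positivity) (by positivity), ENNReal.ofReal_mul (by norm_num),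
          ENNReal.ofReal_mul (by norm_num), ENNReal.ofReal_ofNat]

/-- **R2 `stub_recurrentSlicesZero` of the line `recurrent-past`, signature unfolded** (`Sig.stub_densityMeet`, `InClass`, `WindowDensityZero`,
`returnSet` written out): given R1, a member of Seregin's power-gauged ancient Euler class (`ρ > 0`) whose a.e. slice below `T₁ ≤ 0` is
Poincaré-recurrent (returns in time-averaged `L²(B_R)` up to `ε`, on a set of past times of non-zero window density, for all `R, ε`) has
a.e.-vanishing slices below `T₁`. [folklore] -/
theorem recurrentSlicesZero :
    (∀ Bad Ret : Set ℝ,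
      Tendsto (fun a : ℝ => volume (Bad ∩ Set.Ioo (-(a ^ 2)) 0) / ENNReal.ofReal (a ^ 2)) atTop (𝓝 0) →
      ¬ Tendsto (fun a : ℝ => volume (Ret ∩ Set.Ioo (-(a ^ 2)) 0) / ENNReal.ofReal (a ^ 2)) atTop (𝓝 0) →
        ∃ σ ∈ Ret, σ ∉ Bad) →
    ∀ ρ : ℝ, 0 < ρ → ∀ (u : ℝ → EuclideanSpace ℝ (Fin 3) → EuclideanSpace ℝ (Fin 3))
      (p : ℝ → EuclideanSpace ℝ (Fin 3) → ℝ)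
      (H : ℝ → EuclideanSpace ℝ (Fin 3) → EuclideanSpace ℝ (Fin 3) →L[ℝ] EuclideanSpace ℝ (Fin 3)) (c : ℝ≥0),
      (IsSuitableWeakSolutionOn (slab (EuclideanSpace ℝ (Fin 3)) (Set.Iio 0) isOpen_Iio) 0 0 u p ∧
        HasWeakSpatialGradientOn (slab (EuclideanSpace ℝ (Fin 3)) (Set.Iio 0) isOpen_Iio) u H ∧
        (∀ a : ℝ, 0 < a →
          ENNReal.ofReal (a ^ (2 * ρ)) * cknA a (0 : ℝ × EuclideanSpace ℝ (Fin 3)) u +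
              ENNReal.ofReal (a ^ ρ) * cknE a (0 : ℝ × EuclideanSpace ℝ (Fin 3)) H +
            ENNReal.ofReal (a ^ (2 * ρ)) * cknD a (0 : ℝ × EuclideanSpace ℝ (Fin 3)) p ≤ (c : ℝ≥0∞))) →
      ∀ T₁ : ℝ, T₁ ≤ 0 →
        (∀ᵐ τ₀ ∂(volume.restrict (Set.Iio T₁)),
          ∀ R ε : ℝ, 0 < R → 0 < ε → ∃ h : ℝ, 0 < h ∧
            ¬ Tendsto (fun a : ℝ => volume ({σ : ℝ | σ < 0 ∧
                ∫⁻ τ in Set.Ioo (σ - h) σ, ∫⁻ y in ball (0 : EuclideanSpace ℝ (Fin 3)) R,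
                  ‖u τ y - u τ₀ y‖ₑ ^ 2 < ENNReal.ofReal (h * ε)} ∩ Set.Ioo (-(a ^ 2)) 0) /
              ENNReal.ofReal (a ^ 2)) atTop (𝓝 0)) →
        ∀ᵐ τ ∂(volume.restrict (Set.Iio T₁)), ∫⁻ x, ‖u τ x‖ₑ ^ 2 = 0 := by
  intro hR1 ρ hρ u p H c hcls T₁ hT₁ hrec
  obtain ⟨_hsw, hH, hgauge⟩ := hcls
  have hA : ∀ a : ℝ, 0 < a → ENNReal.ofReal (a ^ (2 * ρ)) *
      cknA a (0 : ℝ × EuclideanSpace ℝ (Fin 3)) u ≤ (c : ℝ≥0∞) :=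
    fun a ha => le_trans (le_trans le_self_add le_self_add) (hgauge a ha)
  have hE : ∀ a : ℝ, 0 < a → ENNReal.ofReal (a ^ ρ) *
      cknE a (0 : ℝ × EuclideanSpace ℝ (Fin 3)) H ≤ (c : ℝ≥0∞) :=
    fun a ha => le_trans (le_trans le_add_self le_self_add) (hgauge a ha)
  -- ## a measurable modification `ut` of `u` on the slab, and its good slices
  have hum : AEStronglyMeasurable (uncurry u)
      (volume.restrict (Set.Iio (0 : ℝ) ×ˢ (univ : Set (EuclideanSpace ℝ (Fin 3))))) := by
    have := hH.locallyIntegrableOn.aestronglyMeasurable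
    simpa [slab] using this
  set ut : ℝ × EuclideanSpace ℝ (Fin 3) → EuclideanSpace ℝ (Fin 3) := hum.mk (uncurry u) with hut
  have hutm : Measurable ut := hum.stronglyMeasurable_mk.measurable
  have hslice : ∀ᵐ t ∂(volume.restrict (Set.Iio (0 : ℝ))),
      ∀ᵐ y ∂(volume : Measure (EuclideanSpace ℝ (Fin 3))), u t y = ut (t, y) := by
    have hae : ∀ᵐ z ∂(volume.restrict (Set.Iio (0 : ℝ) ×ˢ (univ : Set (EuclideanSpace ℝ (Fin 3))))),
        uncurry u z = ut z := hum.ae_eq_mk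
    have hμ : (volume : Measure (ℝ × EuclideanSpace ℝ (Fin 3))).restrict
        (Set.Iio (0 : ℝ) ×ˢ (univ : Set (EuclideanSpace ℝ (Fin 3)))) =
        (volume.restrict (Set.Iio (0 : ℝ))).prod (volume : Measure (EuclideanSpace ℝ (Fin 3))) := by
      rw [Measure.volume_eq_prod, Measure.restrict_prod_eq_prod_univ]
    rw [hμ] at hae
    exact Measure.ae_ae_of_ae_prod hae
  have hslice' : ∀ᵐ t ∂(volume : Measure ℝ), t ∈ Set.Iio (0 : ℝ) →
      ∀ᵐ y ∂(volume : Measure (EuclideanSpace ℝ (Fin 3))), u t y = ut (t, y) :=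
    (ae_restrict_iff' measurableSet_Iio).1 hslice
  -- measurability of the slice functionals of `ut`
  have hutslice : ∀ t : ℝ, Measurable fun y : EuclideanSpace ℝ (Fin 3) => ut (t, y) :=
    fun t => hutm.comp (measurable_const.prodMk measurable_id)
  have hEm : ∀ R : ℝ, Measurable fun t : ℝ => ∫⁻ y in ball (0 : EuclideanSpace ℝ (Fin 3)) R, ‖ut (t, y)‖ₑ ^ 2 :=
    fun R => (hutm.enorm.pow_const 2).lintegral_prod_right'
      (ν := volume.restrict (ball (0 : EuclideanSpace ℝ (Fin 3)) R))
  have hDm : ∀ (R τ₀ : ℝ), Measurable fun t : ℝ =>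
      ∫⁻ y in ball (0 : EuclideanSpace ℝ (Fin 3)) R, ‖ut (t, y) - ut (τ₀, y)‖ₑ ^ 2 := by
    intro R τ₀
    have h2 : Measurable fun z : ℝ × EuclideanSpace ℝ (Fin 3) => ut (τ₀, z.2) :=
      hutm.comp (measurable_const.prodMk measurable_snd)
    exact ((hutm.sub h2).enorm.pow_const 2).lintegral_prod_right'
      (ν := volume.restrict (ball (0 : EuclideanSpace ℝ (Fin 3)) R))
  -- ## reduce to recurrent, good times `τ₀ < T₁`
  have hT : ∀ᵐ τ₀ ∂(volume.restrict (Set.Iio T₁)), τ₀ < T₁ :=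
    (ae_restrict_iff' measurableSet_Iio).2 (Eventually.of_forall fun _ h => h)
  have hsliceT : ∀ᵐ τ₀ ∂(volume.restrict (Set.Iio T₁)),
      ∀ᵐ y ∂(volume : Measure (EuclideanSpace ℝ (Fin 3))), u τ₀ y = ut (τ₀, y) :=
    ae_restrict_of_ae_restrict_of_subset (Set.Iio_subset_Iio hT₁) hslice
  filter_upwards [hrec, hT, hsliceT] with τ₀ hrecτ hτT hgood0
  -- ## STEP 1: every ball energy of the slice `τ₀` vanishes
  have hball : ∀ R : ℝ, 0 < R → ∫⁻ y in ball (0 : EuclideanSpace ℝ (Fin 3)) R, ‖u τ₀ y‖ₑ ^ 2 = 0 := by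
    intro R hR
    refine le_antisymm (ENNReal.le_of_forall_pos_le_add fun δ hδ _ => ?_) bot_le
    rw [zero_add]
    set ε : ℝ := (δ : ℝ) / 10 with hεdef
    have hε : 0 < ε := by rw [hεdef]; exact div_pos (by exact_mod_cast hδ) (by norm_num)
    obtain ⟨h, hh, hRet⟩ := hrecτ R ε hR hε
    -- the bad set, its measurable twin, and their window densities
    set E' : ℝ → ℝ≥0∞ := fun t => ∫⁻ y in ball (0 : EuclideanSpace ℝ (Fin 3)) R, ‖ut (t, y)‖ₑ ^ 2 with hE'
    have hEE' : ∀ᵐ t ∂(volume : Measure ℝ), t ∈ Set.Iio (0 : ℝ) →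
        (∫⁻ y in ball (0 : EuclideanSpace ℝ (Fin 3)) R, ‖u t y‖ₑ ^ 2) = E' t := by
      filter_upwards [hslice'] with t ht hlt
      exact lintegral_congr_ae (ae_restrict_of_ae ((ht hlt).mono fun y hy => by simp only [hy]))
    set Bad : Set ℝ := {t | t < 0 ∧
      ENNReal.ofReal ε < ∫⁻ y in ball (0 : EuclideanSpace ℝ (Fin 3)) R, ‖u t y‖ₑ ^ 2} with hBad
    set Bad' : Set ℝ := {t | t < 0 ∧ ENNReal.ofReal ε < E' t} with hBad'
    have hBad'm : MeasurableSet Bad' :=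
      (measurableSet_lt measurable_id measurable_const).inter (measurableSet_lt measurable_const (hEm R))
    have hBB : (Bad : Set ℝ) =ᵐ[volume] Bad' := by
      filter_upwards [hEE'] with t ht
      simp only [hBad, hBad', eq_iff_iff]
      constructor
      · rintro ⟨h1, h2⟩
        exact ⟨h1, by rwa [← ht h1]⟩
      · rintro ⟨h1, h2⟩
        exact ⟨h1, by rwa [ht h1]⟩
    have hBadWDZ : Tendsto (fun a : ℝ => volume (Bad ∩ Set.Ioo (-(a ^ 2)) 0) / ENNReal.ofReal (a ^ 2)) atTop (𝓝 0) := by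
      have hv := Backward.vanishesBackward_of_gauge hρ hH hA hE hR hε
      refine hv.congr fun a => ?_
      congr 2
      ext t
      simp only [hBad, mem_setOf_eq, mem_inter_iff, mem_Ioo]
      tauto
    have hBad'WDZ := windowDensityZero_congr_ae hBB hBadWDZ
    -- the smeared set, and a return outside it (R1)
    have hS := windowDensityZero_smeared hBad'm hBad'WDZ hh
    obtain ⟨σ, hσRet, hσS⟩ := hR1 _ _ hS hRet
    obtain ⟨hσ0, hσint⟩ := hσRet
    have hσS' : volume (Bad' ∩ Set.Ioo (σ - h) σ) ≤ ENNReal.ofReal (h / 2) := not_lt.1 hσS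
    have hW0 : Set.Ioo (σ - h) σ ⊆ Set.Iio (0 : ℝ) := fun t ht => lt_trans ht.2 hσ0
    -- the deviation from `u(τ₀)` and its measurable twin
    set D' : ℝ → ℝ≥0∞ := fun t =>
      ∫⁻ y in ball (0 : EuclideanSpace ℝ (Fin 3)) R, ‖ut (t, y) - ut (τ₀, y)‖ₑ ^ 2 with hD'
    have hD'm : Measurable D' := hDm R τ₀
    have hDD' : ∀ᵐ t ∂(volume : Measure ℝ), t ∈ Set.Iio (0 : ℝ) →
        (∫⁻ y in ball (0 : EuclideanSpace ℝ (Fin 3)) R, ‖u t y - u τ₀ y‖ₑ ^ 2) = D' t := by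
      filter_upwards [hslice'] with t ht hlt
      refine lintegral_congr_ae (ae_restrict_of_ae ?_)
      filter_upwards [ht hlt, hgood0] with y hy hy0
      rw [hy, hy0]
    have hint' : ∫⁻ t in Set.Ioo (σ - h) σ, D' t < ENNReal.ofReal (h * ε) := by
      have e : ∫⁻ t in Set.Ioo (σ - h) σ, D' t = ∫⁻ t in Set.Ioo (σ - h) σ,
          ∫⁻ y in ball (0 : EuclideanSpace ℝ (Fin 3)) R, ‖u t y - u τ₀ y‖ₑ ^ 2 := by
        refine setLIntegral_congr_fun_ae measurableSet_Ioo ?_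
        filter_upwards [hDD'] with t ht hmem using (ht (hW0 hmem)).symm
      rw [e]
      exact hσint
    -- Chebyshev on the return window
    set G : Set ℝ := {t | ENNReal.ofReal (4 * ε) ≤ D' t} with hG
    have hGm : MeasurableSet G := measurableSet_le measurable_const hD'm
    have hGvol : volume (G ∩ Set.Ioo (σ - h) σ) ≤ ENNReal.ofReal (h / 4) := by
      have hm := mul_meas_ge_le_lintegral₀ (μ := volume.restrict (Set.Ioo (σ - h) σ)) hD'm.aemeasurable
        (ENNReal.ofReal (4 * ε))
      rw [Measure.restrict_apply hGm] at hm
      have h4ε : ENNReal.ofReal (4 * ε) ≠ 0 := (ENNReal.ofReal_pos.2 (by positivity)).ne'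
      have h1 : volume (G ∩ Set.Ioo (σ - h) σ) ≤ (∫⁻ t in Set.Ioo (σ - h) σ, D' t) / ENNReal.ofReal (4 * ε) := by
        rw [ENNReal.le_div_iff_mul_le (Or.inl h4ε) (Or.inl ENNReal.ofReal_ne_top), mul_comm]
        exact hm
      refine h1.trans ?_
      calc (∫⁻ t in Set.Ioo (σ - h) σ, D' t) / ENNReal.ofReal (4 * ε)
          ≤ ENNReal.ofReal (h * ε) / ENNReal.ofReal (4 * ε) := ENNReal.div_le_div_right hint'.le _
        _ = ENNReal.ofReal (h / 4) := by
            rw [← ENNReal.ofReal_div_of_pos (by positivity)]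
            congr 1
            field_simp
    -- the null set of bad slices
    set N : Set ℝ := {t | ¬ (t ∈ Set.Iio (0 : ℝ) →
      ∀ᵐ y ∂(volume : Measure (EuclideanSpace ℝ (Fin 3))), u t y = ut (t, y))} with hN
    have hNvol : volume N = 0 := ae_iff.1 hslice'
    -- a good time in the window
    obtain ⟨τ, hτW, hτB, hτG, hτN⟩ := exists_good_time_in_window hh hσS' hGvol hNvol
    have hτ0 : τ < 0 := hW0 hτW
    have hgoodτ : ∀ᵐ y ∂(volume : Measure (EuclideanSpace ℝ (Fin 3))), u τ y = ut (τ, y) := by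
      have : τ ∈ Set.Iio (0 : ℝ) → ∀ᵐ y ∂(volume : Measure (EuclideanSpace ℝ (Fin 3))), u τ y = ut (τ, y) := by
        by_contra hc
        exact hτN hc
      exact this hτ0
    have hEτ : E' τ ≤ ENNReal.ofReal ε := not_lt.1 fun hlt => hτB ⟨hτ0, hlt⟩
    have hDτ : D' τ < ENNReal.ofReal (4 * ε) := not_le.1 hτG
    -- `∫_{B_R}|u(τ₀)|² ≤ 2 E'(τ) + 2 D'(τ) ≤ 10 ε = δ`
    have hE0 : ∫⁻ y in ball (0 : EuclideanSpace ℝ (Fin 3)) R, ‖u τ₀ y‖ₑ ^ 2 =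
        ∫⁻ y in ball (0 : EuclideanSpace ℝ (Fin 3)) R, ‖ut (τ₀, y)‖ₑ ^ 2 :=
      lintegral_congr_ae (ae_restrict_of_ae (hgood0.mono fun y hy => by simp only [hy]))
    rw [hE0]
    have hm0 : Measurable fun y : EuclideanSpace ℝ (Fin 3) => ‖ut (τ, y)‖ₑ ^ 2 :=
      (hutslice τ).enorm.pow_const 2
    have hm1 : Measurable fun y : EuclideanSpace ℝ (Fin 3) => 2 * ‖ut (τ, y)‖ₑ ^ 2 := hm0.const_mul 2
    have hm2 : Measurable fun y : EuclideanSpace ℝ (Fin 3) => ‖ut (τ, y) - ut (τ₀, y)‖ₑ ^ 2 :=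
      ((hutslice τ).sub (hutslice τ₀)).enorm.pow_const 2
    calc ∫⁻ y in ball (0 : EuclideanSpace ℝ (Fin 3)) R, ‖ut (τ₀, y)‖ₑ ^ 2
        ≤ ∫⁻ y in ball (0 : EuclideanSpace ℝ (Fin 3)) R, (2 * ‖ut (τ, y)‖ₑ ^ 2 + 2 * ‖ut (τ, y) - ut (τ₀, y)‖ₑ ^ 2) :=
          lintegral_mono fun y => enorm_sq_le_two_mul_add _ _
      _ = 2 * E' τ + 2 * D' τ := by
          rw [lintegral_add_left hm1, lintegral_const_mul 2 hm0, lintegral_const_mul 2 hm2]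
      _ ≤ 2 * ENNReal.ofReal ε + 2 * ENNReal.ofReal (4 * ε) :=
          add_le_add (mul_le_mul' le_rfl hEτ) (mul_le_mul' le_rfl hDτ.le)
      _ = (δ : ℝ≥0∞) := by
          rw [← ENNReal.ofReal_ofNat 2, ← ENNReal.ofReal_mul (by norm_num), ← ENNReal.ofReal_mul (by norm_num),
            ← ENNReal.ofReal_add (by positivity) (by positivity), ← ENNReal.ofReal_coe_nnreal]
          congr 1
          rw [hεdef]
          ring
  -- ## STEP 2: the balls `B(0, n+1)` exhaust `ℝ³`
  have huniv : ∫⁻ y, ‖u τ₀ y‖ₑ ^ 2 =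
      ∫⁻ y in ⋃ n : ℕ, ball (0 : EuclideanSpace ℝ (Fin 3)) ((n : ℝ) + 1), ‖u τ₀ y‖ₑ ^ 2 := by
    rw [iUnion_ball_nat_succ, Measure.restrict_univ]
  rw [huniv]
  refine le_antisymm ((lintegral_iUnion_le _ _).trans (le_of_eq ?_)) bot_le
  have hz : ∀ n : ℕ, ∫⁻ y in ball (0 : EuclideanSpace ℝ (Fin 3)) ((n : ℝ) + 1), ‖u τ₀ y‖ₑ ^ 2 = 0 :=
    fun n => hball _ (by positivity)
  simp only [hz, tsum_zero]

end Summit.NavierStokesRegularity.NavierStokesRegularity.Theorems.PowerGaugeEulerLiouville.RecurrentPast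

end
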